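import Summits.QuantumFields.YangMills.Theorems.BalabanUVNodesN12BillH12ForStub1VWK1AxV11OfJunctionRowsMemGuarded

/-!
# BalabanUVNodes ∕ N12 → K1ᴬ — «RUN-KEYED GUARD» EDITION of the h12 BILL (over G4 ✓p835673): the same bill, same witnesses, with the per-run memory guard of the CONCLUSION keyed to
# the RUN — `∃ λW γ₁₂, 0 < γ₁₂ ∧ (∀ P, 1 ≤ P.K → λW.kSel P < P.K) ∧ ∀ P, λW.kSel P < P.K → Step.InInterval γ₁₂ P.K (gOfRecord₁₃Ax θL P) → N0OfRecord₁₃Ax θL P P.K ≤ P.K →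
# B15Leaf (WOfRecord₁₃Ax θL λW P)` — ✦ plan g104's K1ᴬ v11.4 candidate A (the [IV] pin OWED at the selected step on every windowed run whose memory fits the RUN)

Cell `pub-ymgap` (HUMAN RULING D-0062), seat `pub-ymgap-dag-n12-d` g39 (R134 N12 [B15] s2 «knit at the record»); helper of K1ᴬ `stmt-QuantumFields-27239` (DECIDING), `--kind proof
--supports … --as helper`, count-neutral.  Sibling of `BalabanUVNodesN12BillH12ForStub1VWK1AxV11OfJunctionRowsMemGuarded` (this seat g39 ✓p835673; imported — every `open`, every letter, every displayed row and the
proof are that file's, byte-kept except the DECLARED EDITS below).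

WHY (ref-P g18 PRE-READ NOTE «LOCATED-POLARITY» + PS, bus 2026-08-31T23:04Z ∕ 23:06Z, kernel `HollowPinProbe` de3401d91e459ef9; ref-Q g17 KERNEL NOTE 3; ✦ plan g104 ERRATUM + PEN FACTS 2,
23:18Z).  In K1ᴬ v11.3's rung-1ⱽᵂ text — and in G4's conclusion, which copies it — the memory guard `N₀(θ, P, λW.kSel P + 1) ≤ λW.kSel P + 1` is keyed to the PROVER-SELECTED step while the
selection conjunct asks only `λW.kSel P < P.K`; the selection `kSel := 0` turns the guard into `N₀(θ, P, 1) ≤ 1`, FALSE on every windowed run (`N₀ ≥ 2`, LOCATED-g39-2's lemma pair), so the pin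
is inhabited from a junk `ResidW` (`HollowPinProbe.h12FShape_of_any ∕ E8Conclusion_of_pin_only`).  ✦'s v11.4 candidate A keys the guard to the RUN: `N0OfRecord₁₃Ax θ P P.K ≤ P.K` — not
vacatable by any choice of `λW`.  G4's PROOF never used the escape: its witness is `λW := λᴾ` at the step row `hk : λ.kSel P = P.K − 1`, where `kSel P + 1 = P.K` and the two guards
COINCIDE.  This edition states the bill in candidate A's currency: one `omega` and one rewrite convert the run-keyed antecedent into the step-keyed hypothesis G4's junction consumes.

DECLARED EDITS relative to ✓p835673.  (R1) in the conclusion's per-run clause, `N0OfRecord₁₃Ax (Θ.liveRepin₁₃Ax F 2) P (lamW.kSel P + 1) ≤ lamW.kSel P + 1 →` ↦ `N0OfRecord₁₃Ax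
(Θ.liveRepin₁₃Ax F 2) P P.K ≤ P.K →`; (R2) in the proof's final anonymous constructor the last component `hleaf` ↦ `fun P hkP hIP hNK => hleaf P hkP hIP (…)` with `lam.kSel P + 1 = P.K`
from `hk P` and `hkP` (`omega`) and `rw`.  Every displayed row (incl. `hk`), the witnesses `λW := λᴾ`, `γ₁₂ := γβ`, `0 < γ₁₂ := tS.γ_pos` and the selection conjunct are byte-identical.
Namespace `…OfJunctionRowsRunGuarded`, theorem `h12_bill_at_liveRepin₁₃Ax_of_junctionRowsRunGuarded`.

HONEST FRAMING.  Re-packaging (one `omega`, one `rw`); EVERY displayed row of the «memory-guarded rows» junction stays displayed and LEADS ((R) name `h15` + THE ONE-LENGTH STEP TOKEN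
`hstep` (N07, no producer), `Adm`'s rows, the ν₀-pin, the step row `hk`, NODE 00's `hres` ∕ live mass, the term-pin data + 12P §1's residual rows, the β-sign box, the Θ-level numerics,
print's p. 200 conditions, `Λ ≠ ∅`, the ℍ-leaves + (1.80) at the pinned letters, the (J0′) head's instance ∕ cap ∕ budget ∕ tolerance rows); A2 NOT exhibited; nothing of Bałaban asserted;
the bill is NOT paid here; `stub_nodes13PWSVW` NOT closed; N12 NOT discharged; K0ᴬ ∕ K1ᴬ ∕ K3ᴬ OPEN (K1ᴬ 0∕6); counts unmoved (discharged 8∕27 · K 1∕4); one finite 𝕋⁴ programme at fixed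
`ε = L^{-K}` — NOT continuum ∕ ℝ⁴ ∕ OS; NOT the Yang–Mills mass gap (Clay).  THEOREMS ONLY (0 `def`, 0 `sorry`).
Sources (bookkeeping only): [Balaban1989LargeFieldI] (0.2)–(0.6) p.176, p.177 (ii), (1.2) p.178, p.179, Prop. 1 (1.78) p.194, (1.80) p.195, (1.89) p.198, p.200, (1.99)–(1.102)
pp.200–201; [Balaban1985Variational] Thm 1 (8) p.279, Prop. 2 p.281, Prop. 9 (190) pp.308–309; [Balaban1988Convergent] (2.4)–(2.9) pp.255–256, (3.22)–(3.25) pp.269–270;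
[Balaban1987RG1] Thm 1 p.259, §1 p.264, (2.9) p.266.
-/

noncomputable section

open scoped BigOperators ENNReal
open MeasureTheory
open scoped Matrix.Norms.L2Operator
open MeasureTheory Set Finset Metric Filter
open scoped Matrix.Norms.L2Operator BigOperators Matrix RealInnerProductSpace Real InnerProductSpace Topology

namespace Summit.QuantumFields.YangMills.BalabanUVNodes.N12BillH12ForStub1VWK1AxV11OfJunctionRowsRunGuarded

open Summit.QuantumFields.YangMills.BalabanUVNodes.N12AtRecord13Prop1KnitThm1MemGuardedRowsDatumScaleLettersDischargedAtLengthOfRegNameAndStepOfRecordTermPinnedAx (exists_constants_thresholds_radius_areg_pinLF_b15Leaf_WOfRecord₁₃_pinAllΛΩχZ_N0_liveRepin₁₃_memGuardedRowsDatumScale_lettersDischargedAtLength_termPinned_ofRegNameGB_ofStepGB_ax)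

open Literature.MathematicalPhysics.QuantumFieldTheory.Balaban1983to89.B15DeterminingSetsB
open Literature.MathematicalPhysics.QuantumFieldTheory.Balaban1983to89
open Literature.MathematicalPhysics.QuantumFieldTheory.Balaban1983to89.T4Continuum (T4Family LStep Letter walk walkEnd netDisp holAt)
open Literature.MathematicalPhysics.QuantumFieldTheory.Balaban1983to89.DagBinding
open Literature.MathematicalPhysics.QuantumFieldTheory.Balaban1983to89.Node00
open FlowStep (prefixOf BetaLowerH BetaUpperH)
open B15Claim189Assembly (new189 chiPP dom half)
open B15 (Prop1Printed Ineq180)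
open B15.BasicStep (Claim189)
open B8Eq17ClassAkV1 (plaqsOf)
open B14.Eq216Concrete (inputs feeds)
open GaugeGroup (dist1)
open GaugeField (plaqHol gaugeAct)
open B15RPrime1100OfRep (rPrimeDataOfSel)
open T4CubeChartGnomonic (SU2)
open B15Prop1ChartSU2 (su2Chart)
open B15Prop1SliceCoordinates (GaugeSlice ιA)
open T4AxialGaugeSmallField (castSite boxPlaqs boxBonds)
open B6BondElimination (unitVec)
open B6TreeGaugePoincare (curl)
open B16Eq18Proof (box)
open B15Extension193 (extend)
open B15ShellGauge193 (shellGauge)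
open B15Sect1Instances (fun177stdB)
open B14.Eq213DetSet (Bj maxDomT)
open B14.Eq213MaximalDomains (side)
open B14.Eq22Determines (blockIter IsBlockUnion)
open Literature.MathematicalPhysics.QuantumFieldTheory.BalabanImbrieJaffe1984to88.BIJ85Eq453GaugeField (qsstarGIter0)
open B16Sect1Backgrounds (expMul toMS)
open B15DeterminingSets (pts DetBackground genSet IsMinimizer MSField avgFamily bondsOf DetSet embIter AgreeOn)
open B5Eq118OneStroke (iterBlockOf)
open Literature.MathematicalPhysics.QuantumFieldTheory.Balaban1983to89.Node00 (coeField constrEnumB)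
open B15Eq112TorusCover (lift)
open ExpMeanLog (deltaSU)
open B15Prop1Carrier (lfVarOn InstOn InstOn.std InstOn.stdB plaqsInside)
open Summit.QuantumFields.YangMills.BalabanUVNodes.N12AtRecord13Prop1KnitThm1WindowDirectDatumScaleLettersDischargedAtLengthOfRegNameAndStepOfRecord (thm1LetterT_atLength_pTop_of_variationalThm1RegSepCoP7MGB_lamTop)
open B15Claim189Assembly (Setting189)
open B14DomainGeom (Pt)
open B15.PrelimIntegrations (Ineq191 Ineq195)
open B15Chi124DetSets (E124)
open B15Claim189PrintedConditions (omegaOfChain)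
open B15Claim189PinsOfHistory (N0OfRecord₁₃)
open B15Claim189LambdaPin (enlD)
open Summit.QuantumFields.YangMills.BalabanUVNodes.N12MinimiserFamilyKnitRowThm1LettersAtLengthOnZOfRecordBR (exists_R_hMinRow_of_thm1LettersAtLength_alongOrbit_onZ_ofRecord)
open Summit.QuantumFields.YangMills.BalabanUVNodes.N12Thm1LettersAtLengthOfK0GridGB (thm1LetterT_atLength_of_variationalThm1RegSepCoP7MGB)
open B15Prop1NumericsThresholds (plaqSmallOn_of_le)
open B15Prop1MinimiserClassAtDatumScaleAtLengthB (isMinimizerB_withEps_base_of_thm1AtLength isMinimizerB_withEps_of_norm_lt_atLength lamBondsSeq_congr)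
open Summit.QuantumFields.YangMills.BalabanUVNodes.N12DirectChartPackageOfClassRowL1FamilyB (exists_hWD_chartHalf_of_class_uniform_rowl1_family)
open Summit.QuantumFields.YangMills.BalabanUVNodes.N12Prop1DirectOfClassOnlyRowL1UniformBLam (exists_rowPreimageProxiesLetter_family_uniformB_lamBondsSeq)
open Summit.QuantumFields.YangMills.BalabanUVNodes.N12Prop1DirectOfClassOnlyB (exists_curvatureLetters_family)
open Summit.QuantumFields.YangMills.BalabanUVNodes.N12MinimiserFamilyKnitRowThm1Letters (boxRow3_of_boxRow5)
open T4AdjointCovarianceUnitary (lieSU)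
open B15Prop1GradientFromNearValueAtCoPRecord (far_letter_of_box)
open B15Prop1AnalyticExtClause (cplxVec anExt)
open B15Prop1ChartCalculusSU2 (E3)
open B15Sect1Instances (lamDatumP)
open B11Thm1ExistsUniqueTokensGB (VariationalThm1EUSepCoP7MGB VariationalThm1EUStepCoP7MGB)
open B11Thm1ExistsUniqueInductionG (truncSeq)
open Summit.QuantumFields.YangMills.BalabanUVNodes.N12EUStepTokensAtRealisedDataLam (variationalThm1EUSepCoP7MGB_realised_of_step_of_reg_lamTop)
open Summit.QuantumFields.YangMills.BalabanUVNodes.N12Thm1LettersAtLengthOfK0GridGB (blockSat_torusClassSeq)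
open Summit.QuantumFields.YangMills.BalabanUVNodes.N12Thm1LettersAtLengthOfK0GridGB (thm1LetterEU_atLength_of_variationalThm1EUSepCoP7MGB)
open B15Claim189PinsOfHistory (N0OfRecord₁₃Chi N0OfRecord₁₃Ax)
open B14FlowStep (SmallnessFor)


section
variable {F : T4Family}

/-- ★★ **«RUN-KEYED GUARD» EDITION (the conclusion's per-run memory guard reads `N0OfRecord₁₃Ax θL P P.K ≤ P.K` — a property of the RUN and of `θ`, not of the prover's selected step — ✦ plan g104's K1ᴬ v11.4 candidate A after ref-P g18's LOCATED-POLARITY (`HollowPinProbe`): the step-keyed guard of v11.3 is vacated by `kSel := 0`, the run-keyed one is not; at this bill's selected step `kSel P = P.K − 1` (row `hk`) the two guards coincide, `kSel P + 1 = P.K`; otherwise = the edition (dag-n12-d g39, LOCATED-g39-2 ∕ MISSING ESTIMATE N12 #57 of record ∕ ref-Q g17 KERNEL NOTE 1: 12P §1's level row `tNk : N₀(θL,P,kSel+1) ≤ kSel+1` — print's «N > N₀», [IV] p.179 — is no longer a displayed row but the PER-RUN MEMORY GUARD of the bill's own conclusion, in ✦ plan g104's (R-a′) currency; every coupling-dependent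 per-run row is asked on the runs inside the window whose memory fits; the «window-local rows» bill ✓p835078 it supersedes is VACUOUS as a conditional (its rows `hk tup tS hr1 tNk` contradict at the K = 1 window run); CONCLUSION = the (R-a′) h12 body) of N12's BILL `h12` OF `stub_nodes13PWSVW` (dag-n24-c g24 (Q) `…N24Stub1VWShareK1AxV11` §4, bills AT A WITNESS FAMILY) FROM N12's JUNCTION ROWS** — the window-local junction
at the re-centred record (✓p812482) with its final block RE-PACKAGED as (Q)'s N12 bill body: `∃ λW γ₁₂, 0 < γ₁₂ ∧ (∀ P, 1 ≤ P.K → λW.kSel P < P.K) ∧ ∀ P, λW.kSel P < P.K →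
Step.InInterval γ₁₂ P.K (gOfRecord₁₃Ax θL P) → B15Leaf (WOfRecord₁₃Ax θL λW P)` at `θL := Θ.liveRepin₁₃Ax F 2` — which IS (Q)'s `h12` body at `θ.toStage13Params` for every member of a
witness family BUILT ON THE RE-PIN, definitionally (the face's family `theta13OfThm1CCMWZBAx … = (theta13OfNumericsZ …).liveRepin₁₃Ax`: `(θ).liveRepin₁₃Ax = θ` by `rfl`, kernel-checked).
Witnesses: `λW := λᴾ` = the junction's fully pinned layer (LF pinned to the Prop-1 carrier on `areg`, (1.100) by `pinRPrime₁₃Ax`, (1.80)∕(1.89) by `pinD189ΛH` on the term-pin data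
`σ sq Nm p₁`) at the step `λ.kSel P = P.K − 1` (new leading row `hk`; then `1 ≤ P.K → λW.kSel P < P.K` is arithmetic), `γ₁₂ := γβ` = the level of the displayed β-sign box (new sign row
`0 < γβ`).  EVERY OTHER ROW OF ✓p812482 LEADS, VERBATIM ((R) name `h15` + THE ONE-LENGTH STEP TOKEN `hstep` (N07, no producer), `Adm`'s rows, the ν₀-pin, NODE 00's `hres` ∕ live-mass, the
term-pin data + 12P §1's per-run rows, `BetaLowerH bβ γβ (betaOfRecord₁₃Ax θL)`, (2.8a), the ℍ-leaves + (1.80) at the pinned letters, the (J0′) head's instance ∕ cap ∕ budget ∕ tolerance rows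
under `∃ R` ∕ `∀ eR` ∕ `∀ δ`).  NOT a discharge of N12; the bill is PAID only when those rows are.
[cite: Balaban1989LargeFieldI, (0.2)–(0.6) p.176, (1.2) p.178, Prop. 1 (1.77)–(1.78) p.194, (1.80) p.195, (1.89) p.198, (1.99)–(1.102) pp.200–201; Balaban1985Variational, Thm 1 (8) p.279, Prop. 2 p.281, Prop. 9 (190) pp.308–309; Balaban1988Convergent, (2.8) p.256, (3.22)–(3.25) pp.269–270; Balaban1987RG1, Thm 1 p.259, (2.9) p.266] -/
theorem h12_bill_at_liveRepin₁₃Ax_of_junctionRowsRunGuarded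
    (hd3 : ∀ P : B12.RunParams, 3 ≤ (F.P P.K).d)
    (h0 : ∀ P : B12.RunParams, 0 < (F.P P.K).d)
    (ι : B12.RunParams → Type)
    {B₃ a₀ a₁' : ℝ}
    (Z Λ : ∀ P : B12.RunParams, ι P → Set (Site (F.P P.K) 0))
    (k : ∀ P : B12.RunParams, ι P → ℕ)
    (M : ∀ P : B12.RunParams, ι P → ℝ)
    (hk0 : ∀ (P : B12.RunParams) (i : ι P), 0 < k P i)
    (hk1 : ∀ (P : B12.RunParams) (i : ι P), k P i + 1 ≤ (F.P P.K).m + (F.P P.K).K)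
    (T : ∀ (P : B12.RunParams) (i : ι P), Finset (PBond (F.P P.K) (k P i)))
    (lo hi : ∀ P : B12.RunParams, ι P → Fin (F.P P.K).d → ℤ)
    (n : ∀ P : B12.RunParams, ι P → ℕ)
    (hn : ∀ (P : B12.RunParams) (i : ι P) κ, hi P i κ ≤ lo P i κ + n P i)
    (hN : ∀ (P : B12.RunParams) (i : ι P), n P i + 2 < (F.P P.K).sitesPerDir (k P i))
    (hbox : ∀ (P : B12.RunParams) (i : ι P), pts (k P i) (Λ P i) = (castSite '' Set.Icc (lo P i) (hi P i) : Set (Site (F.P P.K) (k P i))))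
    (hZ : ∀ (P : B12.RunParams) (i : ι P), (boxPlaqs (lo P i - 1) (hi P i + 1) : Set (Plaq (F.P P.K) (k P i))) ⊆ plaqsInside (pts (k P i) (Z P i)))
    (hTG0 : ∀ (P : B12.RunParams) (i : ι P), T P i = (box (fun κ => (hi P i κ - lo P i κ + 1).toNat) (lo P i)).image fun x =>
      (⟨castSite (x - unitVec ⟨0, h0 P⟩), ⟨0, h0 P⟩⟩ : PBond (F.P P.K) (k P i)))
    (hN5 : ∀ (P : B12.RunParams) (i : ι P) κ, ((hi P i κ - lo P i κ + 1).toNat : ℤ) + 5 < (F.P P.K).sitesPerDir (k P i))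
    (Kb : ∀ P : B12.RunParams, ι P → ℕ)
    (hK1 : ∀ (P : B12.RunParams) (i : ι P), 1 ≤ Kb P i)
    (hKn : ∀ (P : B12.RunParams) (i : ι P) κ, (hi P i κ - lo P i κ + 1).toNat ≤ Kb P i)
    (ext : ∀ (P : B12.RunParams) (i : ι P), GaugeField (F.P P.K) (k P i) SU2 → GaugeField (F.P P.K) (k P i) SU2)
    (hext : ∀ (P : B12.RunParams) (i : ι P) Vk, ext P i Vk = extend (pts (k P i) (Λ P i)) (shellGauge Vk (lo P i) (hi P i)) Vk)
    (hlohi : ∀ (P : B12.RunParams) (i : ι P), lo P i ≤ hi P i)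
    (LO HI : ∀ P : B12.RunParams, ι P → Fin (F.P P.K).d → ℤ)
    (hLO : ∀ (P : B12.RunParams) (i : ι P), LO P i ≤ lo P i - 1)
    (hHI : ∀ (P : B12.RunParams) (i : ι P), hi P i + 1 ≤ HI P i)
    (n' : ∀ P : B12.RunParams, ι P → ℕ)
    (hn' : ∀ (P : B12.RunParams) (i : ι P) κ, HI P i κ ≤ LO P i κ + n' P i)
    (hn'N : ∀ (P : B12.RunParams) (i : ι P), n' P i < (F.P P.K).sitesPerDir (k P i))
    (hR' : ∀ (P : B12.RunParams) (i : ι P), (boxPlaqs (LO P i) (HI P i) : Set (Plaq (F.P P.K) (k P i))) ⊆ plaqsInside (pts (k P i) (Z P i)))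
    {γ₈ bx : B12.RunParams → ℝ}
    (hγ : ∀ P : B12.RunParams, 0 < γ₈ P)
    (hbx : ∀ P : B12.RunParams, 0 ≤ bx P)
    (hbxM : ∀ (P : B12.RunParams) (i : ι P), 12 * ((F.P P.K).d : ℝ) * ((n P i : ℝ) + 2) ^ 2 ≤ bx P * (M P i) ^ 2)
    (hM : ∀ (P : B12.RunParams) (i : ι P), 1 ≤ (M P i))
    (W : ∀ P : B12.RunParams, ι P → Finset (Plaq (F.P P.K) 0))
    (hWbox : ∀ (P : B12.RunParams) (i : ι P), ∀ q : Plaq (F.P P.K) 0, q.src ∈ ((box (fun κ => (F.P P.K).L ^ (k P i) * ((hi P i κ - lo P i κ + 1).toNat + 3 + 1) - 1) (fun κ => ((F.P P.K).L : ℤ) ^ (k P i) * (lo P i κ - 2))).image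
        (fun z => (castSite z : Site (F.P P.K) 0))) → q ∈ W P i)
    (c : ∀ P : B12.RunParams, ι P → ℕ)
    (hkc : ∀ (P : B12.RunParams) (i : ι P), k P i + c P i ≤ (F.P P.K).m + (F.P P.K).K)
    (hc : ∀ (P : B12.RunParams) (i : ι P), 4 * (F.P P.K).d + (3 * ((F.P P.K).d * (((F.P P.K).L - 1) / 2)) + 5) + 3 < 2 * (F.P P.K).L ^ c P i)
    (X : ∀ P : B12.RunParams, ι P → Set (Site (F.P P.K) 0))
    (D₀ : ∀ P : B12.RunParams, ι P → ℕ)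
    (hBox : ∀ (P : B12.RunParams) (i : ι P), ∀ x ∈ X P i, ∀ w : List (Letter (F.P P.K).d),
      w.length ≤ (∑ i' ∈ Finset.range (k P i + 1), ((F.P P.K).d * (((F.P P.K).L ^ i' - 1) / 2) + 1)) + (3 * ((F.P P.K).d * (((F.P P.K).L - 1) / 2)) + 5) * (F.P P.K).L ^ k P i + (F.P P.K).L ^ k P i →
      ∀ μ : Fin (F.P P.K).d, (⟨B14.Eq22Determines.blockIter (k P i) (walkEnd x w), μ⟩ : PBond (F.P P.K) (k P i)) ∈ (boxBonds (LO P i) (HI P i) : Set (PBond (F.P P.K) (k P i))))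
    (hWX : ∀ (P : B12.RunParams) (i : ι P), ∀ p ∈ W P i, p.src ∈ X P i ∧ p.src.shift p.μ ∈ X P i ∧ p.src.shift p.ν ∈ X P i ∧ (p.src.shift p.μ).shift p.ν ∈ X P i ∧ (p.src.shift p.ν).shift p.μ ∈ X P i)
    (hfeedsX : ∀ (P : B12.RunParams) (i : ι P) (ν' : Fin (F.P P.K).d), ∀ z ∈ box (fun κ => (hi P i κ - lo P i κ + 1).toNat + 3) (fun κ => lo P i κ - 2), ∀ b₀ : PBond (F.P P.K) 0,
      (b₀ ∈ feeds (k P i) (⟨(castSite z : Site (F.P P.K) (k P i)), ⟨0, h0 P⟩⟩ : PBond (F.P P.K) (k P i)) ∨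
        b₀ ∈ feeds (k P i) (⟨((castSite z : Site (F.P P.K) (k P i))).shift ⟨0, h0 P⟩, ν'⟩ : PBond (F.P P.K) (k P i)) ∨
        b₀ ∈ feeds (k P i) (⟨((castSite z : Site (F.P P.K) (k P i))).shift ν', ⟨0, h0 P⟩⟩ : PBond (F.P P.K) (k P i)) ∨
        b₀ ∈ feeds (k P i) (⟨(castSite z : Site (F.P P.K) (k P i)), ν'⟩ : PBond (F.P P.K) (k P i))) → b₀.src ∈ X P i ∧ b₀.tgt ∈ X P i)
    {cE cA : B12.RunParams → ℝ}
    (hcE0 : ∀ P : B12.RunParams, 0 ≤ cE P)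
    (hcE : ∀ (P : B12.RunParams) (i : ι P), 12 * ((F.P P.K).d : ℝ) * ((n P i : ℝ) + 2) ^ 2 ≤ cE P)
    (hγle : ∀ (P : B12.RunParams) (i : ι P), γ₈ P / (M P i) ^ 5 ≤ 1 / 2 / (2 * (3 * (Kb P i : ℝ) ^ 2 + 2 * (Kb P i : ℝ) ^ 4)))
    (hZblk : ∀ (P : B12.RunParams) (i : ι P), IsBlockUnion (k P i) (Z P i))
    (hB₃ : 0 < B₃)
    -- [15] THEOREM 1 (8) = (R), GUARD-GENERIC NAMED FACT in K0⁷'s house AT PRINT's CURRENCY `(lamDatum F, dataSmall7LamTopOf F 2)` (`Adm : StepGuard F`; at `Adm := A‴(c,c₀,c₁)` and the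
    -- stub's constants = K0⁷'s V23 stub 1ᴮ `K0V23Defs.Prop8StepCoPGridGBAt` through k0-s1-w1's 53′; INHABITED there by `K0Stub1BHolds` ∕ this seat's 112 — at GENERIC constants: displayed)
    (Adm : Node00.StepGuard F) (h15 : VariationalThm1RegSepCoP7MGB F 2 Adm (lamDatum F) (dataSmall7LamTopOf F 2) B₃ a₀ a₁')
    -- THE GUARD's TWO STRUCTURAL ROWS print's induction (11)–(14) reads: the standing range and stability under truncation (`truncSeq`); at `A‴` both are arithmetic (dag-n12-c ✓p782972)
    (hAdmK : ∀ ν M' g K k' (s : SeqOfRecord F ν M' g K k'), Adm ν M' g K k' s → k' ≤ (F.P K).m + (F.P K).K)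
    (hAdmTr : ∀ ν M' g K k' (s : SeqOfRecord F ν M' g K (k' + 1)), 0 < k' → Adm ν M' g K (k' + 1) s → Adm ν M' g K k' (truncSeq s))
    -- THE (J0′) HEAD's SKELETON ROWS AT εreg-BLIND NUMERICS `ν₀` (the head of record ✓p740879 is instantiated at `ν₀`; `Θ.ν` is pinned to `ν₀` off the class threshold below)
    (ν₀ : Node00.Stage7Numerics)
    (hdiv₀ : ∀ (P : B12.RunParams) (i : ι P), side (F.P P.K).L ν₀.M₁ (k P i) ∣ (F.P P.K).sitesPerDir 0)
    (hfloor₀ : ∀ P : B12.RunParams, ((F.P P.K).d + 14) * (F.P P.K).L ≤ ν₀.M₁)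
    (hMrad₀ : ∀ P : B12.RunParams, (4 * (F.P P.K).d + (3 * ((F.P P.K).d * (((F.P P.K).L - 1) / 2)) + 5)) * (F.P P.K).L ^ 2 + 2 * (F.P P.K).d * (F.P P.K).L + 12 ≤ ν₀.M₁)
    (hM₁₀ : ∀ P : B12.RunParams, (((F.P P.K).d + 4) * (F.P P.K).L + 6) * (F.P P.K).L ^ 2 ≤ ν₀.M₁)
    -- THE GUARD ROW at the head's εreg-blind numerics `ν₀`, per instance, along the degenerate history `(M, g) := (ν₀.M₁, 1)` (β's `hadm`; at `A‴`: `c ≤ ν₀.M₁`, `k P i + c₀ ≤ m + K`, `L^{c₁} ∣ ν₀.M₁`)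
    (hadm₀ : ∀ (P : B12.RunParams) (i : ι P) (s₁ : SeqOfRecord F ν₀ ν₀.M₁ (fun _ => (1 : ℝ)) P.K (k P i)), Adm ν₀ ν₀.M₁ (fun _ => (1 : ℝ)) P.K (k P i) s₁)
    -- the BOX SCOPE row of the head (every `k`-bond inside `Z^{(k)}` is a bond of the region box)
    (hscope : ∀ (P : B12.RunParams) (i : ι P), {e : PBond (F.P P.K) (k P i) | e.src ∈ pts (k P i) (Z P i) ∧ e.tgt ∈ pts (k P i) (Z P i)} ⊆ boxBonds (LO P i) (HI P i))
    -- the analytic family's bound scale (`𝓐₀ P i := 4·𝓐₁`)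
    (𝓐₁ : ℝ) (h𝓐₁ : 1 < 𝓐₁)
    -- IN PLACE OF [15] THEOREM 1 (E∕U)'s NAME: THE ONE-LENGTH STEP TOKEN ᴮ at the SAME guard and the SAME constants, print's currency `(lamDatum F, dataSmall7LamTopOf F 2)`, for any ONE `C₁` with
    -- `2L³ ≤ C₁`, `8L³ < C₁B₃` ([15] Prop. 2 + Sects. B–E at ONE length given `U₀` with (14); «INHABITED BY»: OPEN — N07's obligation; the (E∕U)ᴮ name AT REGULAR-REALISED DATA follows from it
    -- and `h15` by dag-n12-c g38's `variationalThm1EUSepCoP7MGB_realised_of_step_of_reg_lamTop` ✓p782780 — SUPPLY-at-1 ∕ LIFT proved there)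
    {C₁ : ℝ} (hC₁ : 2 * (F.L : ℝ) ^ 3 ≤ C₁) (hCB : 8 * (F.L : ℝ) ^ 3 < C₁ * B₃)
    (hstep : VariationalThm1EUStepCoP7MGB F 2 Adm (lamDatum F) (dataSmall7LamTopOf F 2) C₁ B₃ a₀ a₁') :
    -- THE THREE THRESHOLDS of the (J0′) head, announced from (ν₀, P.K, Z P i, k P i, the two [15] names) BEFORE Θ ∕ the class threshold ∕ the data budget (U4-existential, instance-dependent)
    ∃ ρJ εW δ₀ : ∀ P : B12.RunParams, ι P → ℝ, (∀ P i, 0 < ρJ P i) ∧ (∀ P i, 0 < εW P i) ∧ (∀ P i, 0 < δ₀ P i) ∧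
    -- THE NINE LETTER CONSTANTS of the chart half (`C ρ Kτ ρτ ρ5`), the (P4)′ row (`εH B₁`), the small-below ∕ curvature letters (`ρ6 M₂`) — functions of `(P.K, k P)`, from the uniform producers
    ∃ C ρ Kτ ρτ ρ5 εH B₁ ρ6 M₂ : ∀ P : B12.RunParams, ι P → ℝ, (∀ P i, 0 ≤ C P i) ∧ (∀ P i, 0 < ρ P i) ∧ (∀ P i, 0 ≤ Kτ P i) ∧ (∀ P i, 0 < ρτ P i) ∧ (∀ P i, 0 < ρ5 P i) ∧
      (∀ P i, 0 < εH P i) ∧ (∀ P i, 0 ≤ B₁ P i) ∧ (∀ P i, 0 < ρ6 P i) ∧ (∀ P i, 0 ≤ M₂ P i) ∧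
    ∀ (Θ : Stage13Params F 2) (lam : ResidW F 2), (∀ P : B12.RunParams, lam.kSel P = P.K - 1) → { ν₀ with εreg := Θ.ν.εreg } = Θ.ν →
      (Θ.HasResidualsOfRecord F 2) →
      -- «WINDOW-LOCAL ROWS» (dag-n12-d g39): the window level `γβ` (= the bill's `γ₁₂`) + β-sign box FIRST; NEW Θ-level rows in place of 12P §1's `tlog tε0 tε1 tflow` (+ `tβ₀0 tβ₀ tγ0 tγ1`)
      ∀ (β₀ bβ γβ : ℝ), (0 ≤ bβ) → (BetaLowerH bβ γβ (betaOfRecord₁₃Ax F 2 (Θ.liveRepin₁₃Ax F 2))) →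
      (1 ≤ Θ.ν.r) → (0 ≤ Θ.ν.A₀) → ∀ (β' : ℝ), (BetaUpperH β' γβ (betaOfRecord₁₃Ax F 2 (Θ.liveRepin₁₃Ax F 2))) → ∀ (Lς : ℕ), (SmallnessFor γβ β' β₀ Lς Θ.ν.p₀) →
      (γβ * p0Profile Θ.ν.A₀ Θ.ν.p₀ γβ ≤ 1 / 10) →
      (∀ P : B12.RunParams, lam.kSel P < P.K → Step.InInterval γβ P.K (gOfRecord₁₃Ax F 2 (Θ.liveRepin₁₃Ax F 2) P) → N0OfRecord₁₃Ax (Θ.liveRepin₁₃Ax F 2) P (lam.kSel P + 1) ≤ lam.kSel P + 1 → ∀ s, LiveSeq F 2 Θ.ν Θ.τ9 P (gOfRecord₁₃Ax F 2 (Θ.liveRepin₁₃Ax F 2) P) (lam.kSel P + 1)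
        (slotsTOfRecord F 2 Θ.ν Θ.τ9 (EOfRecord₁₃Ax F 2 (Θ.liveRepin₁₃Ax F 2)) (wOfRecord₉ F 2 (Θ.liveRepin₁₃Ax F 2).toStage9Params)
          (Θ.liveRepin₁₃Ax F 2).ppSel P (gOfRecord₁₃Ax F 2 (Θ.liveRepin₁₃Ax F 2) P) (lam.kSel P + 1)) s →
      0 < ∫ V, rterm (reprTOfRecord₁₃Chi F 2 (Θ.liveRepin₁₃Ax F 2) (chiβOfRecord₁₃Ax F 2 Θ) P (lam.kSel P)) s V ∂(fieldMeasure (F.P P.K) (lam.kSel P + 1) (SU 2))) →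
      -- THE TERM PINS (167ᴾ ∕ 12P ✓p516715 §1) in place of the free rows at `λ.D1100 ∕ λ.D189`: data `σ sq Nm p₁ Dst`, then 12P §1's rows run by run below the torus
      ∀ (σ : ∀ P : B12.RunParams, Sit189 F 2 P.K),
      ∀ (sq : ∀ P : B12.RunParams, SeqOfRecord F Θ.ν Θ.τ9.M (gOfRecord₁₃Ax F 2 (Θ.liveRepin₁₃Ax F 2) P) P.K (lam.kSel P + 1)),
      ∀ (Nm : B12.RunParams → ℕ),
      ∀ (p₁ : ℕ),
      (0 < Θ.ν.M₂) →
      (0 < Θ.τ9.M) →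
      ∀ (Dst : ∀ P : B12.RunParams, Setting189 (F.P P.K) (SU 2) (MSField (F.P P.K) (SU 2) × ((j : ℕ) → VecField (F.P P.K) j (EuclideanSpace ℝ (Fin (2 ^ 2 - 1))))) (Pt (F.P P.K).d)),
      (∀ P : B12.RunParams, Dst P = ((ResidW.pinRPrime₁₃Ax lam (Θ.liveRepin₁₃Ax F 2)).pinD189ΛH (Θ.liveRepin₁₃Ax F 2).ν (Θ.liveRepin₁₃Ax F 2).A₁ (Θ.liveRepin₁₃Ax F 2).τ9.M (gOfRecord₁₃Ax F 2 (Θ.liveRepin₁₃Ax F 2)) (fun P => (((((σ P).pinZres Θ.ν Θ.τ9.M (gOfRecord₁₃Ax F 2 (Θ.liveRepin₁₃Ax F 2) P) (sq P) (N0OfRecord₁₃Ax (Θ.liveRepin₁₃Ax F 2) P (lam.kSel P + 1))).pinSides Θ.ν (gOfRecord₁₃Ax F 2 (Θ.liveRepin₁₃Ax F 2) P) (lam.kSel P + 1 - Nm P) (lam.kSel P + 1)).pinXΩ4 (sq P) (enlD F Θ.ν Θ.τ9.M P (gOfRecord₁₃Ax F 2 (Θ.liveRepin₁₃Ax F 2)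 P))).pinOmegaPP (sq P) (Nm P) (enlD F Θ.ν Θ.τ9.M P (gOfRecord₁₃Ax F 2 (Θ.liveRepin₁₃Ax F 2) P)))) sq Nm p₁).D189 P) →
      (∀ P : B12.RunParams, lam.kSel P < P.K → Step.InInterval γβ P.K (gOfRecord₁₃Ax F 2 (Θ.liveRepin₁₃Ax F 2) P) → N0OfRecord₁₃Ax (Θ.liveRepin₁₃Ax F 2) P (lam.kSel P + 1) ≤ lam.kSel P + 1 → N0OfRecord₁₃Ax (Θ.liveRepin₁₃Ax F 2) P (lam.kSel P + 1) ≤ Nm P) →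
      (∀ P : B12.RunParams, lam.kSel P < P.K → 0 ≤ (σ P).β) →
      (∀ P : B12.RunParams, lam.kSel P < P.K → (σ P).β ≤ 1 / 4) →
      (∀ P : B12.RunParams, lam.kSel P < P.K → 2 ≤ (σ P).L₀) →
      (∀ P : B12.RunParams, lam.kSel P < P.K → (σ P).L₀ ^ 2 ≤ ((F.P P.K).L : ℝ)) →
      (∀ P : B12.RunParams, lam.kSel P < P.K → 0 ≤ (σ P).O1 * (σ P).B₃ * (σ P).B₅) →
      (∀ P : B12.RunParams, lam.kSel P < P.K → 0 ≤ (σ P).δ) →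
      (∀ P : B12.RunParams, lam.kSel P < P.K → Step.InInterval γβ P.K (gOfRecord₁₃Ax F 2 (Θ.liveRepin₁₃Ax F 2) P) → N0OfRecord₁₃Ax (Θ.liveRepin₁₃Ax F 2) P (lam.kSel P + 1) ≤ lam.kSel P + 1 → (2 + (121 / 120) ^ 2 * ((σ P).O1 * (σ P).B₃ * (σ P).B₅ * (Θ.τ9.M : ℝ) ^ 5)) *
      ((((σ P).L₀ ^ 2) ^ (N0OfRecord₁₃Ax (Θ.liveRepin₁₃Ax F 2) P (lam.kSel P + 1) - 1))⁻¹) ≤ 1 / 4) →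
      (∀ P : B12.RunParams, lam.kSel P < P.K → (121 / 120) ^ 2 * ((σ P).O1 * (σ P).B₃ * (σ P).B₅ * (Θ.τ9.M : ℝ) ^ 5) * Real.exp (-(4 * (σ P).δ * (Θ.τ9.M : ℝ))) ≤ 1 / 12) →
      (∀ P : B12.RunParams, lam.kSel P < P.K → Step.InInterval γβ P.K (gOfRecord₁₃Ax F 2 (Θ.liveRepin₁₃Ax F 2) P) → N0OfRecord₁₃Ax (Θ.liveRepin₁₃Ax F 2) P (lam.kSel P + 1) ≤ lam.kSel P + 1 → (((enlD F Θ.ν Θ.τ9.M P (gOfRecord₁₃Ax F 2 (Θ.liveRepin₁₃Ax F 2) P)) 4 (lam.kSel P + 1 + 1 - (N0OfRecord₁₃Ax (Θ.liveRepin₁₃Ax F 2) P (lam.kSel P + 1)))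
        (omegaOfChain (sq P) (lam.kSel P + 1 + 1 - (N0OfRecord₁₃Ax (Θ.liveRepin₁₃Ax F 2) P (lam.kSel P + 1)))))ᶜ ∩ (σ P).Z).Nonempty) →
      (∀ P : B12.RunParams, lam.kSel P < P.K → Step.InInterval γβ P.K (gOfRecord₁₃Ax F 2 (Θ.liveRepin₁₃Ax F 2) P) → N0OfRecord₁₃Ax (Θ.liveRepin₁₃Ax F 2) P (lam.kSel P + 1) ≤ lam.kSel P + 1 → ∀ U, new189 (Dst P) U → ∀ p ∈ plaqsOf (half (Dst P)),
      Ineq191 (dist1 (plaqHol ((Dst P).Upp U) p)) ((Dst P).devV'' U p) (Dst P).α (((Dst P).L ^ (Dst P).h)⁻¹) ((Dst P).ε (Dst P).h) (E124 (Dst P).ε (Dst P).L (Dst P).η (Dst P).k (Dst P).h)) →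
      (∀ P : B12.RunParams, lam.kSel P < P.K → Step.InInterval γβ P.K (gOfRecord₁₃Ax F 2 (Θ.liveRepin₁₃Ax F 2) P) → N0OfRecord₁₃Ax (Θ.liveRepin₁₃Ax F 2) P (lam.kSel P + 1) ≤ lam.kSel P + 1 → ∀ U, new189 (Dst P) U → ∀ p ∈ plaqsOf (half (Dst P)),
      Ineq195 ((Dst P).devV'' U p) (dist1 (plaqHol ((Dst P).Uhalf U ((Dst P).boxOf p)) p)) (Dst P).α (((Dst P).L ^ (Dst P).h)⁻¹) ((Dst P).ε (Dst P).h) (E124 (Dst P).ε (Dst P).L (Dst P).η (Dst P).k (Dst P).h)) →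
      (∀ P : B12.RunParams, lam.kSel P < P.K → Step.InInterval γβ P.K (gOfRecord₁₃Ax F 2 (Θ.liveRepin₁₃Ax F 2) P) → N0OfRecord₁₃Ax (Θ.liveRepin₁₃Ax F 2) P (lam.kSel P + 1) ≤ lam.kSel P + 1 → ∀ U, new189 (Dst P) U → ∀ j, (Dst P).h ≤ j → j ≤ (Dst P).k → ∀ p ∈ plaqsOf (dom (Dst P) j),
      Ineq191 (dist1 (plaqHol ((Dst P).Upp U) p)) ((Dst P).dev97 U p) (Dst P).α (((Dst P).L ^ j)⁻¹) ((Dst P).ε j) (E124 (Dst P).ε (Dst P).L (Dst P).η (Dst P).k j)) →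
      (∀ P : B12.RunParams, lam.kSel P < P.K → Step.InInterval γβ P.K (gOfRecord₁₃Ax F 2 (Θ.liveRepin₁₃Ax F 2) P) → N0OfRecord₁₃Ax (Θ.liveRepin₁₃Ax F 2) P (lam.kSel P + 1) ≤ lam.kSel P + 1 → ∀ U, new189 (Dst P) U → ∀ j, (Dst P).h ≤ j → j ≤ (Dst P).k → ∀ p ∈ plaqsOf (dom (Dst P) j),
      Ineq191 ((Dst P).dev97 U p) ((Dst P).dev0 U p) (Dst P).α (((Dst P).L ^ j)⁻¹) ((Dst P).ε j) (E124 (Dst P).ε (Dst P).L (Dst P).η (Dst P).k j)) →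
      (∀ P : B12.RunParams, lam.kSel P < P.K → Step.InInterval γβ P.K (gOfRecord₁₃Ax F 2 (Θ.liveRepin₁₃Ax F 2) P) → N0OfRecord₁₃Ax (Θ.liveRepin₁₃Ax F 2) P (lam.kSel P + 1) ≤ lam.kSel P + 1 → ∀ U, new189 (Dst P) U → ∀ j, (Dst P).h ≤ j → j ≤ (Dst P).k → ∀ p ∈ plaqsOf (dom (Dst P) j),
      Ineq180 ((Dst P).dev0 U p) ((Dst P).ε (Dst P).k) (Dst P).η (Dst P).B₃ (Dst P).B₅ (Dst P).M (Dst P).δ ((Dst P).dist p) (Dst P).O1) →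
      (∀ (P : B12.RunParams) (i : ι P), ∀ (ν' : Fin (F.P P.K).d), ∀ z ∈ box (fun κ => (hi P i κ - lo P i κ + 1).toNat + 3) (fun κ => lo P i κ - 2),
      (castSite z : Site (F.P P.K) (k P i)) ∈ pts (k P i) (maxDomT Θ.ν.M₁ (Z P i) (k P i)) ∧
        (castSite z : Site (F.P P.K) (k P i)).shift ⟨0, h0 P⟩ ∈ pts (k P i) (maxDomT Θ.ν.M₁ (Z P i) (k P i)) ∧
        (castSite z : Site (F.P P.K) (k P i)).shift ν' ∈ pts (k P i) (maxDomT Θ.ν.M₁ (Z P i) (k P i))) →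
      (∀ P : B12.RunParams, (143 * (((((F.P P.K).d + 4 : ℕ) : ℝ)) ^ 2 / 4) ^ 2) * (Θ.ν.εreg * (F.P P.K).L ^ 2) ≤ 1 / 3) →
      (∀ P : B12.RunParams, 2 * (Θ.ν.εreg * (F.P P.K).L ^ 2) ≤ 2 * deltaSU (Fin 2) / ((((F.P P.K).d + 4) * (F.P P.K).L : ℕ) : ℝ) ^ 2) →
      (∀ P : B12.RunParams, (((((F.P P.K).d + 2) * (F.P P.K).L : ℕ) : ℝ) ^ 2 / 4) * (2 * (Θ.ν.εreg * (F.P P.K).L ^ 2)) < deltaSU (Fin 2)) →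
      (∀ (P : B12.RunParams) (i : ι P), ∀ x ∈ X P i, ∃ x₀ ∈ maxDomT Θ.ν.M₁ (Z P i) (k P i), ∃ w₀ : List (Letter (F.P P.K).d), w₀.length ≤ D₀ P i ∧ walkEnd x₀ w₀ = x) →
      (∀ (P : B12.RunParams) (i : ι P), D₀ P i + 3 * (∑ i' ∈ Finset.range (k P i + 1), ((F.P P.K).d * (((F.P P.K).L ^ i' - 1) / 2) + 1)) + ((3 * ((F.P P.K).d * (((F.P P.K).L - 1) / 2)) + 5) + 5) * (F.P P.K).L ^ k P i +
      (((F.P P.K).d + 4) * (F.P P.K).L + 2) * (∑ l ∈ Finset.Ico 0 (k P i), (F.P P.K).L ^ l) + 4 ≤ (F.P P.K).L ^ (k P i - 1) * Θ.ν.M₁) →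
      (∀ P : B12.RunParams, 4 * (F.P P.K).L ≤ Θ.ν.M₁) →
      (∀ (P : B12.RunParams) (i : ι P) (y : Site (F.P P.K) 0), B14.Eq22Determines.blockIter (k P i) y ∈ (castSite '' Set.Icc (lo P i - 1) (hi P i + 1) : Set (Site (F.P P.K) (k P i))) → y ∈ maxDomT Θ.ν.M₁ (Z P i) 1) →
      (∀ (P : B12.RunParams) (i : ι P), side (F.P P.K).L Θ.ν.M₁ (k P i) ∣ (F.P P.K).sitesPerDir 0) →
      (∀ (P : B12.RunParams) (i : ι P), 1 / 2 * (B₃ * (cE P + 1) * (F.P P.K).eta 1 ^ 2) ^ 2 * (Nat.card {q : Plaq (F.P P.K) 0 // q ∈ plaqsOf (maxDomT Θ.ν.M₁ (Z P i) 1)} : ℝ) ≤ cA P) →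
      (2 ≤ Θ.ν.M₁) →
      (0 < Θ.ν.εreg) →
      (Θ.ν.εreg ≤ a₀) →
      -- THE GUARD CAP `eG` and the cap-level datum tolerance `ρnG` with the head's rows at the cap (all upper bounds on `eG`, `ρnG`, `Θ.ν.εreg`)
      ∀ (eG ρnG : ∀ P : B12.RunParams, ι P → ℝ), (∀ (P : B12.RunParams) (i : ι P), 0 < eG P i) →
      (∀ (P : B12.RunParams) (i : ι P), 6 * ((((F.P P.K).d - 1 : ℕ)) : ℝ) * (F.P P.K).L ^ (k P i) * (2 * ((cE P + 1) * eG P i)) ≤ ρJ P i) →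
      (∀ (P : B12.RunParams) (i : ι P), 12 * ((((F.P P.K).d - 1 : ℕ)) : ℝ) * (F.P P.K).L * Θ.ν.εreg ≤ ρJ P i) →
      (∀ (P : B12.RunParams) (i : ι P), Θ.ν.εreg ≤ εW P i) →
      (∀ P : B12.RunParams, (143 * (((((F.P P.K).d + 4 : ℕ) : ℝ)) ^ 2 / 4) ^ 2) * (2 * ((F.P P.K).L : ℝ) ^ 2 * Θ.ν.εreg) ≤ 1 / 3) →
      (∀ P : B12.RunParams, 2 * (2 * ((F.P P.K).L : ℝ) ^ 2 * Θ.ν.εreg) ≤ 2 * deltaSU (Fin 2) / ((((F.P P.K).d + 4) * (F.P P.K).L : ℕ) : ℝ) ^ 2) →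
      (∀ (P : B12.RunParams) (i : ι P), (cE P + 1) * (2 * eG P i) ≤ a₁' ∧ B₃ * ((cE P + 1) * (2 * eG P i)) ≤ Θ.ν.εreg) →
      (Θ.ν.εreg < a₀) →
      (∀ (P : B12.RunParams) (i : ι P), 0 ≤ ρnG P i) →
      (∀ (P : B12.RunParams) (i : ι P), max (ρnG P i) ((((2 * (∑ i' ∈ Finset.range (k P i + 1), ((F.P P.K).d * (((F.P P.K).L ^ i' - 1) / 2) + 1)) + 1 +
                  (3 * ((F.P P.K).d * (((F.P P.K).L - 1) / 2)) + 5) * (F.P P.K).L ^ (k P i) : ℕ) : ℝ)) ^ 2 / 4 * (Θ.ν.εreg * (F.P P.K).eta 0 ^ 2) +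
                ((3 * ((F.P P.K).d * (((F.P P.K).L - 1) / 2)) + 5 : ℕ) : ℝ) * (6 * ((((((F.P P.K).d + 2) * (F.P P.K).L : ℕ) : ℝ) ^ 2 / 4) * (2 * (Θ.ν.εreg * (F.P P.K).L ^ 2))) * ∑ i' ∈ Finset.range (k P i), ((F.P P.K).L : ℝ) ^ i') + ((3 * ((F.P P.K).d * (((F.P P.K).L - 1) / 2)) + 5 : ℕ) : ℝ) * ρnG P i) ≤ δ₀ P i) →
      (∀ (P : B12.RunParams) (i : ι P), (((F.P P.K).d : ℝ) * n' P i + 1) * ((((F.P P.K).d - 1 : ℕ) : ℝ) * n' P i * ((12 * (F.P P.K).d * (n P i + 2) ^ 2 + 1) * eG P i) + 3 * (F.P P.K).d * (n P i + 2) ^ 2 * eG P i) ≤ ρnG P i) →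
      -- THE (J0′) RADIUS, announced BEFORE the data budget `eR`
      ∃ R : ∀ P : B12.RunParams, ι P → ℝ, (∀ P i, 0 < R P i) ∧
      ∀ (eR : ∀ P : B12.RunParams, ι P → ℝ), (∀ (P : B12.RunParams) (i : ι P), 0 < eR P i) → (∀ (P : B12.RunParams) (i : ι P), eR P i ≤ eG P i) →
      ∀ (ρn : ∀ P : B12.RunParams, ι P → ℝ),
      (∀ (P : B12.RunParams) (i : ι P), (((F.P P.K).d : ℝ) * n' P i + 1) * ((((F.P P.K).d - 1 : ℕ) : ℝ) * n' P i * ((12 * (F.P P.K).d * (n P i + 2) ^ 2 + 1) * eR P i)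
      + 3 * (F.P P.K).d * (n P i + 2) ^ 2 * eR P i) ≤ ρn P i) →
      ∀ (cJ : B12.RunParams → ℝ), (∀ P : B12.RunParams, 0 ≤ cJ P) →
      (∀ (P : B12.RunParams) (i : ι P), (cE P + 1) * (2 * eR P i) ≤ a₁' ∧ B₃ * ((cE P + 1) * (2 * eR P i)) ≤ Θ.ν.εreg) →
      (∀ (P : B12.RunParams) (i : ι P), 6 * ((((F.P P.K).d - 1 : ℕ)) : ℝ) * (F.P P.K).L * (2 * B₃ * (cE P + 1) * eR P i) ≤ ρ5 P i) →
      (∀ (P : B12.RunParams) (i : ι P), 6 * ((((F.P P.K).d - 1 : ℕ)) : ℝ) * (F.P P.K).L * (2 * B₃ * (cE P + 1) * eR P i) ≤ ρ6 P i) →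
      (∀ (P : B12.RunParams) (i : ι P), 2 * cA P * eR P i / R P i + 2 * ((Nat.card {q : Plaq (F.P P.K) 0 // q ∈ plaqsOf (maxDomT Θ.ν.M₁ (Z P i) 1)} : ℝ) * (1 + 8 * (4 * 𝓐₁) ^ 4)) / (R P i * eR P i) ≤ cJ P) →

    ∀ δ : ∀ P : B12.RunParams, ι P → ℝ, (∀ P i, 0 < δ P i) →
      -- the endpoint's EXPLICIT THRESHOLD per run (every quantity a displayed binder or a count of the run's instance — no `∃ δ₀`), then its TOLERANCE rows at `δ P i`
      (∀ (P : B12.RunParams) (i : ι P), δ P i ≤ min (min (min (ρ P i) (ρτ P i) / 2)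
        (min 1 (1 / 2 / (2 * (3 * (Kb P i : ℝ) ^ 2 + 2 * (Kb P i : ℝ) ^ 4)) /
          (max ((32 * (((F.P P.K).d : ℝ) - 1) + 8 * (((F.P P.K).d : ℝ) - 1) + (2 * (((F.P P.K).d : ℝ) - 1) * B₁ P i * (((∑ j ∈ Finset.range (k P i + 1), (2 * (F.P P.K).d) ^ j : ℕ) : ℝ) * M₂ P i))) * (12 * (4 * 𝓐₁) / R P i * Real.sqrt (Nat.card {b : PBond (F.P P.K) 0 // b ∈ {b : PBond (F.P P.K) 0 | b.src ∈ maxDomT Θ.ν.M₁ (Z P i) 1 ∨ b.tgt ∈ maxDomT Θ.ν.M₁ (Z P i) 1}})) ^ 2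
            + (8 * (((F.P P.K).d : ℝ) + 1) * (2 * (Kτ P i + 1)) + 8 * ((F.P P.K).d : ℝ) * (((box (fun κ => (hi P i κ - lo P i κ + 1).toNat + 3) (fun κ => lo P i κ - 2)).image (fun z => (castSite z : Site (F.P P.K) (k P i)))).card : ℝ) * (C P i * (12 * (4 * 𝓐₁) / R P i * Real.sqrt (Nat.card {b : PBond (F.P P.K) 0 // b ∈ {b : PBond (F.P P.K) 0 | b.src ∈ maxDomT Θ.ν.M₁ (Z P i) 1 ∨ b.tgt ∈ maxDomT Θ.ν.M₁ (Z P i) 1}}))) ^ 2)) 0 + 1)))) (εH P i)) →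
      ∀ (hfloor : ∀ (P : B12.RunParams) (i : ι P), ((((4 * (F.P P.K).d + (3 * ((F.P P.K).d * (((F.P P.K).L - 1) / 2)) + 5) + 3 : ℕ) : ℝ)) ^ 2 * ((F.P P.K).L : ℝ) ^ 2 / 4 + ((3 * ((F.P P.K).d * (((F.P P.K).L - 1) / 2)) + 5 : ℕ) : ℝ) * (24 * (((((F.P P.K).d + 2) * (F.P P.K).L : ℕ) : ℝ) ^ 2 / 4))) * (2 * B₃ * (cE P + 1) * eR P i) + ((3 * ((F.P P.K).d * (((F.P P.K).L - 1) / 2)) + 5 : ℕ) : ℝ) * ρn P i ≤ δ P i),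
      ∃ (lamW : ResidW F 2) (γ₁₂ : ℝ), 0 < γ₁₂ ∧ (∀ P : B12.RunParams, 1 ≤ P.K → lamW.kSel P < P.K) ∧
        ∀ P : B12.RunParams, lamW.kSel P < P.K → Step.InInterval γ₁₂ P.K (gOfRecord₁₃Ax F 2 (Θ.liveRepin₁₃Ax F 2) P) →
          N0OfRecord₁₃Ax (Θ.liveRepin₁₃Ax F 2) P P.K ≤ P.K →
          B15Leaf (WOfRecord₁₃Ax F 2 (Θ.liveRepin₁₃Ax F 2) lamW P) := by
  obtain ⟨ρJ, εW, δ₀, hρJ, hεW, hδ₀, C, ρ, Kτ, ρτ, ρ5, εH, B₁, ρ6, M₂, hC, hρ, hKτ, hρτ, hρ5, hεH, hB1, hρ6, hM₂0, hmain⟩ :=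
    exists_constants_thresholds_radius_areg_pinLF_b15Leaf_WOfRecord₁₃_pinAllΛΩχZ_N0_liveRepin₁₃_memGuardedRowsDatumScale_lettersDischargedAtLength_termPinned_ofRegNameGB_ofStepGB_ax
      hd3 h0 ι Z Λ k M hk0 hk1 T lo hi n hn hN hbox hZ hTG0 hN5 Kb hK1 hKn ext hext hlohi LO HI hLO hHI n' hn' hn'N hR' hγ hbx hbxM hM W hWbox c hkc hc X D₀ hBox hWX hfeedsX hcE0 hcE hγle hZblk hB₃ Adm h15 hAdmK hAdmTr ν₀ hdiv₀ hfloor₀ hMrad₀ hM₁₀ hadm₀ hscope 𝓐₁ h𝓐₁ hC₁ hCB hstep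
  refine ⟨ρJ, εW, δ₀, hρJ, hεW, hδ₀, C, ρ, Kτ, ρτ, ρ5, εH, B₁, ρ6, M₂, hC, hρ, hKτ, hρτ, hρ5, hεH, hB1, hρ6, hM₂0, ?_⟩
  intro Θ lam hk hν₀ hres β₀ bβ γβ tb tlow hr1 hA₀ β' tup Lς tS t10 hmassLive σ sq Nm p₁ tM₂ tMτ Dst hDst tNN tβ0 tβ tL₀ tL₀L tB tδ tN₀ tMl tΛ L91h L95 L91 L97 L80
    hΩw hα3 hα2 haN hXΩ hfit hM4 hZ1 hdiv hcA hM2 hεreg ha₀ eG ρnG heG hρJ1 hρJ2 hεWr hα3h hα2h haG ha₀s hρnG0 hT hnormG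
  obtain ⟨R, hR, hrest⟩ := hmain Θ lam hν₀ hres β₀ bβ γβ tb tlow hr1 hA₀ β' tup Lς tS t10 hmassLive σ sq Nm p₁ tM₂ tMτ Dst hDst tNN tβ0 tβ tL₀ tL₀L tB tδ tN₀ tMl tΛ
    L91h L95 L91 L97 L80 hΩw hα3 hα2 haN hXΩ hfit hM4 hZ1 hdiv hcA hM2 hεreg ha₀ eG ρnG heG hρJ1 hρJ2 hεWr hα3h hα2h haG ha₀s hρnG0 hT hnormG
  refine ⟨R, hR, ?_⟩
  intro eR heR heRG ρn hρn cJ hcJ heRa hερ hερ6 hcJ' δ hδ hδle hfloor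
  obtain ⟨areg, hapos, hleaf⟩ := hrest eR heR heRG ρn hρn cJ hcJ heRa hερ hερ6 hcJ' δ hδ hδle hfloor
  -- THE BILL's WITNESSES: `λW := λᴾ` (the fully pinned layer of the junction, verbatim) at the step `kSel P = P.K − 1`, `γ₁₂ := γβ` (the level of the displayed β-sign box)
  exact ⟨((ResidW.pinRPrime₁₃Ax { lam with LF := fun P => lfVarOn su2Chart fun i => InstOn.stdB (Node00.bgMSCoPOfRecordB F 2 Θ.ν P.K (k P i) (maxDomT Θ.ν.M₁ (Z P i))) Θ.ν.M₁ lamDatumP (Z P i) (Λ P i) (k P i) (M P i) (areg P i) (anExt (pts (k P i) (Λ P i)) (T P i) (fun177stdB (Node00.bgMSCoPOfRecordB F 2 Θ.ν P.K (k P i) (maxDomT Θ.ν.M₁ (Z P i))) Θ.ν.M₁ lamDatumP (Z P i) (k P i)) (ext P i) (min (1 / 2) (min (R P i / 8) (γ₈ P / (M P i) ^ 5 * (R P i / 2) ^ 2 / (48 * (4 * ((Nat.card {q : Plaq (F.P P.K) 0 // q ∈ plaqsOf (maxDomT Θ.ν.M₁ (Z P i) 1)} : ℝ) * (1 + 8 *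 (4 * 𝓐₁) ^ 4)) / R P i + 1)))))) } (Θ.liveRepin₁₃Ax F 2)).pinD189ΛH (Θ.liveRepin₁₃Ax F 2).ν (Θ.liveRepin₁₃Ax F 2).A₁ (Θ.liveRepin₁₃Ax F 2).τ9.M (gOfRecord₁₃Ax F 2 (Θ.liveRepin₁₃Ax F 2)) (fun P => (((((σ P).pinZres Θ.ν Θ.τ9.M (gOfRecord₁₃Ax F 2 (Θ.liveRepin₁₃Ax F 2) P) (sq P) (N0OfRecord₁₃Ax (Θ.liveRepin₁₃Ax F 2) P (lam.kSel P + 1))).pinSides Θ.ν (gOfRecord₁₃Ax F 2 (Θ.liveRepin₁₃Ax F 2) P) (lam.kSel P + 1 - Nm P) (lam.kSel P + 1)).pinXΩ4 (sq P) (enlD F Θ.ν Θ.τ9.M P (gOfRecord₁₃Ax F 2 (Θ.liveRepin₁₃Ax F 2) P))).pinOmegaPP (sq P) (Nm P) (enlD F Θ.ν Θ.τ9.M P (gOfRecord₁₃Ax F 2 (Θ.liveRepin₁₃Ax F 2) P)))) sq Nm p₁),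
    γβ, tS.γ_pos, fun P hP => by show lam.kSel P < P.K; rw [hk P]; omega,
    -- the RUN-KEYED guard `N₀(θL, P, K) ≤ K` IS the step-keyed one at the selected step `kSel P = P.K − 1` (row `hk`): `kSel P + 1 = P.K`
    fun P hkP hIP hNK => hleaf P hkP hIP (by
      have h1 : lam.kSel P + 1 = P.K := by have h0 : lam.kSel P < P.K := hkP; rw [hk P] at h0 ⊢; omega
      have h2 : N0OfRecord₁₃Ax (Θ.liveRepin₁₃Ax F 2) P (lam.kSel P + 1) ≤ lam.kSel P + 1 := by rw [h1]; exact hNK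
      exact h2)⟩


end

end Summit.QuantumFields.YangMills.BalabanUVNodes.N12BillH12ForStub1VWK1AxV11OfJunctionRowsRunGuarded

end
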